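import Literature.Computability.MetaComplexity.FregeThresholdStep
import HarnessLib

/-!
# Counting the used holes of `PHP^{n+1}_n` in Frege: formulas, frames and the stage step

Topic `Literature/Computability/MetaComplexity`. The pigeonhole-specific layer of the
quasi-polynomial-size `textbookFrege` proofs of `pigeonholeForm (n+1) n = ¬ ⋀ PHP^{n+1}_n`
(`FregePigeonholeUpperBound.lean`) by divide-and-conquer counting (`FregeThresholdStep.lean`).
With the atoms `p_{i,j}` (`KrajicekRamsey.pv n i j`) and `R = ⋀ PHP^{n+1}_n` (`KrajicekRamsey.php n`):

* `used n i j = p_{i-1,j} ∨ ⋯ ∨ p_{0,j} ∨ ⊥` — "hole `j` is used by a pigeon `< i`";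
  `inp n i l` — the `2^E` inputs of stage `i`: `used n i l` for `l < n`, `⊥` for the padding;
* the frames `frame₁` (tail `¬R`) and `frame₂ i j` (tail `¬p_{i,j}, ¬R`) for the counting
  lemmas, with parameters `prmD E = 2E + 20` (depth), `prmB n E` (size);
* the clause facts as sequents: `pigeonS` (`⊢ p_{i,0}, …, p_{i,n-1}, ¬R`), and in the case
  "pigeon `i` sits in hole `j`": `growS` (`used i l → used (i+1) l`), `offS` (`¬ used i j`, from
  the hole clauses) and `onS` (`used (i+1) j`);
* `stageS` — **the stage step** `⊢ ¬ thr (inp i) i, thr (inp (i+1)) (i+1), ¬R`: at least `i`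
  used holes before pigeon `i` give at least `i + 1` after it (the successor step
  `Frame.stepS` in each case `j`, the cases cut away with the pigeon clause).

References: S. R. Buss, *Polynomial size proofs of the propositional pigeonhole principle*,
J. Symbolic Logic 52 (1987) 916–927 (PHP from counting in Frege); A. Haken, *The
intractability of resolution*, TCS 39 (1985) (the clauses of `PHP^{n+1}_n`); J. R. Shoenfield,
*Mathematical Logic* (1967), §3.1.
-/

namespace Literature.Computability.MetaComplexity

open Complexity Complexity.PropForm TextbookFrege ThrCount
open KrajicekRamsey (pv php holeClauseS pigeonClause_mem clauseOf_pigeonClause msum_phpClauses_le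
  size_php_le dd_neg_php_le msum_map_pv clauseExtractS)

namespace PhpCount

/-! ### The formulas -/

section Defs

variable (n : ℕ)

/-- `used n i j`: hole `j` is used by one of the pigeons `0, …, i-1` — the right-nested
disjunction `p_{i-1,j} ∨ (⋯ ∨ (p_{0,j} ∨ ⊥))`. [folklore] -/
def used : ℕ → ℕ → PropForm ℕ
  | 0, _ => const false
  | i + 1, j => disj (pv n i j) (used i j)

/-- The inputs of stage `i`: `used n i l` for the holes `l < n`, the constant `⊥` for the
padding indices `l ≥ n`. [folklore] -/
def inp (i l : ℕ) : PropForm ℕ :=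
  if l < n then used n i l else const false

/-- The atoms `p_{i-1,j}, …, p_{0,j}` of `used n i j`. [folklore] -/
def usedList (i j : ℕ) : List (PropForm ℕ) :=
  ((List.range i).reverse).map fun i' => pv n i' j

end Defs

variable {n : ℕ}

/-- `used 0 j = ⊥`. [folklore] -/
@[simp] theorem used_zero (j : ℕ) : used n 0 j = const false := rfl

/-- `used (i+1) j = p_{i,j} ∨ used i j`. [folklore] -/
theorem used_succ (i j : ℕ) : used n (i + 1) j = disj (pv n i j) (used n i j) := rfl

/-- `used i j` is the list disjunction of its atoms. [folklore] -/
theorem used_eq_disjList (i j : ℕ) : used n i j = disjList (usedList n i j) := by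
  induction i with
  | zero => rfl
  | succ i ih =>
    rw [used_succ, ih, usedList, usedList, List.range_succ, List.reverse_append, List.reverse_singleton,
      List.singleton_append, List.map_cons, disjList_cons]

/-- Membership in `usedList`. [folklore] -/
theorem mem_usedList_iff {i j : ℕ} {X : PropForm ℕ} : X ∈ usedList n i j ↔ ∃ i' < i, X = pv n i' j := by
  simp only [usedList, List.mem_map, List.mem_reverse, List.mem_range]
  constructor
  · rintro ⟨i', h, rfl⟩; exact ⟨i', h, rfl⟩
  · rintro ⟨i', h, rfl⟩; exact ⟨i', h, rfl⟩

/-- Length of `usedList`. [folklore] -/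
@[simp] theorem length_usedList (i j : ℕ) : (usedList n i j).length = i := by simp [usedList]

/-- Size of `used i j`: `2 i + 1`. [folklore] -/
theorem size_used (i j : ℕ) : (used n i j).size = 2 * i + 1 := by
  induction i with
  | zero => rfl
  | succ i ih => rw [used_succ]; simp only [size, pv] at ih ⊢; omega

/-- `used i j` is a disjunction of atoms: disjunct depth `0`. [folklore] -/
theorem dd_used (i j : ℕ) : (used n i j).dd = 0 := by
  induction i with
  | zero => rfl
  | succ i ih => rw [used_succ, dd_disj, ih]; simp [pv]

/-- Size of an input of stage `i ≤ n + 1`. [folklore] -/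
theorem size_inp_le {i : ℕ} (hi : i ≤ n + 1) (l : ℕ) : (inp n i l).size ≤ 2 * n + 3 := by
  unfold inp
  split_ifs
  · rw [size_used]; omega
  · simp [size]

/-- Inputs have disjunct depth `0`. [folklore] -/
theorem dd_inp (i l : ℕ) : (inp n i l).dd = 0 := by
  unfold inp
  split_ifs
  · exact dd_used i l
  · simp

/-- Inputs at live indices. [folklore] -/
theorem inp_of_lt {i l : ℕ} (h : l < n) : inp n i l = used n i l := if_pos h

/-- Inputs at padding indices are `⊥`. [folklore] -/
theorem inp_of_le {i l : ℕ} (h : n ≤ l) : inp n i l = const false := if_neg (by omega)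

/-! ### Parameters and frames -/

section Params

variable (n E : ℕ)

/-- Depth parameter `2E + 20` (threshold formulas of level `E` have disjunct depth `≤ 2E`;
the reductions of `KrajicekRamseyReduction.lean` work at depth parameter `20`). [folklore] -/
def prmD : ℕ := 2 * E + 20

/-- Size parameter: `64 · tsz (2n+3) E + 200 (n+1)^4 + 200`. [folklore] -/
def prmB : ℕ := 64 * tsz (2 * n + 3) E + 200 * (n + 1) ^ 4 + 200

/-- Length parameter `2^E + 14`. [folklore] -/
def prmM : ℕ := 2 ^ E + 14

variable {n E}

/-- The tails have bounded depth. [folklore] -/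
theorem dd_tail_le {L : List (PropForm ℕ)}
    (hL : ∀ X ∈ L, X = neg (php n) ∨ ∃ i j, X = neg (pv n i j)) : ∀ X ∈ L, X.dd ≤ 2 * E + 12 := by
  intro X hX
  rcases hL X hX with rfl | ⟨i, j, rfl⟩
  · exact dd_neg_php_le.trans (by omega)
  · simp [pv]

/-- The frame with tail `L` (of member sum `≤ 8 (n+1)^4 + 6`, members `¬R` or `¬p_{i,j}`,
length `≤ 2`). [folklore] -/
def frameOf (hn : n ≤ 2 ^ E) (L : List (PropForm ℕ))
    (hL : ∀ X ∈ L, X = neg (php n) ∨ ∃ i j, X = neg (pv n i j))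
    (hLs : msum L ≤ 8 * (n + 1) ^ 4 + 6) (hLl : L.length ≤ 2) : Frame where
  D := prmD E
  B := prmB n E
  p := 2 * E + 12
  σ := 2 * n + 3
  δ := 0
  E := E
  K := 2 ^ E
  M := prmM E
  L := L
  hσ := by omega
  hLd := dd_tail_le hL
  hp := by omega
  hD := by simp [prmD]
  hK := le_rfl
  hM := by simp only [prmM]; have := hn; omega
  hB := by simp only [prmB]; omega

/-- The frame with tail `¬R`. [folklore] -/
abbrev frame₁ (hn : n ≤ 2 ^ E) : Frame :=
  frameOf hn [neg (php n)] (by simp) (by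
    have := size_php_le (n := n); simp only [msum_cons, msum_nil, size]; omega) (by simp)

/-- The frame of the case "pigeon `i` sits in hole `j`": tail `¬p_{i,j}, ¬R`. [folklore] -/
abbrev frame₂ (hn : n ≤ 2 ^ E) (i j : ℕ) : Frame :=
  frameOf hn [neg (pv n i j), neg (php n)] (by
    intro X hX; simp only [List.mem_cons, List.not_mem_nil, or_false] at hX
    rcases hX with rfl | rfl
    · exact Or.inr ⟨i, j, rfl⟩
    · exact Or.inl rfl) (by
    have := size_php_le (n := n); simp only [msum_cons, msum_nil, size, pv]; omega) (by simp)

/-- The inputs of a stage `i ≤ n + 1` are good for the frames. [folklore] -/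
theorem good_inp (hn : n ≤ 2 ^ E) {L : List (PropForm ℕ)} (hL hLs hLl) {i : ℕ} (hi : i ≤ n + 1) :
    (frameOf hn L hL hLs hLl).Good (inp n i) :=
  fun l => ⟨size_inp_le hi l, (dd_inp i l).le⟩

end Params

/-! ### The clauses as sequents -/

section Clauses

variable {E : ℕ} (hn : n ≤ 2 ^ E)

/-- Numeric facts about the parameters. [folklore] -/
theorem prm_facts : 200 * (n + 1) ^ 4 ≤ prmB n E ∧ 20 ≤ prmD E ∧
    64 * tsz (2 * n + 3) E + 200 ≤ prmB n E ∧ 2 * n + 3 ≤ tsz (2 * n + 3) E :=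
  ⟨by simp [prmB]; omega, by simp [prmD], by simp [prmB], le_tsz _ _⟩

include hn in
/-- The length parameter exceeds `n + 14`. [folklore] -/
theorem prmM_ge : n + 14 ≤ prmM E := by simp [prmM]; omega

/-- **The pigeon clause** `⊢ p_{i,0}, …, p_{i,n-1}, ¬R` (`i < n + 1`), extracted from `R` and
flattened. [cite: Haken1985, §1 (the clauses of PHP)] -/
theorem pigeonS {i : ℕ} (hi : i < n + 1) :
    BD (prmD E) (prmB n E) (3000 * (n + 2) ^ 4)
      (disjList ((List.range n).map (pv n i) ++ [neg (php n)])) := by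
  obtain ⟨hB1, hD1, -, -⟩ := prm_facts (n := n) (E := E)
  have hc1 : n + 1 ≤ (n + 1) ^ 4 := Nat.le_self_pow (by norm_num) _
  have hPHP := msum_phpClauses_le (n := n)
  have hH := size_php_le (n := n)
  have hP := msum_map_pv (n := n) i
  have hPlen : ((List.range n).map (pv n i)).length = n := by simp
  have dH := dd_neg_php_le (n := n)
  have hd4 : ∀ X ∈ neg (php n) :: disjList ((List.range n).map (pv n i)) ::
      ((List.range n).map (pv n i) ++ [neg (php n)]), X.dd ≤ 4 := by
    intro X hX
    simp only [List.mem_cons, List.mem_append, List.mem_map, List.mem_range, List.not_mem_nil,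
      or_false] at hX
    rcases hX with rfl | rfl | ⟨j, -, rfl⟩ | rfl
    · exact dH
    · refine (dd_disjList_le (p := 0) fun Y hY => ?_).trans (by omega)
      obtain ⟨j, -, rfl⟩ := List.mem_map.1 hY; simp [pv]
    · simp [pv]
    · exact dH
  have ephp : PropForm.ofCNF (pigeonholeCNF (n + 1) n) = php n := by rw [php]
  have e0 : BD (prmD E) (prmB n E) (130 * (8 * (n + 1) ^ 4 + 3))
      (disjList [neg (php n), disjList ((List.range n).map (pv n i))]) := by
    have := clauseExtractS (D := prmD E) (B := prmB n E) (N := 8 * (n + 1) ^ 4 + 3)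
      (pigeonClause_mem hi) (by omega) (by omega) (by omega)
    rwa [ephp, clauseOf_pigeonClause] at this
  have e1 : BD (prmD E) (prmB n E) (130 * (8 * (n + 1) ^ 4 + 3) + 50 * (n + 3 + 1) ^ 2)
      (disjList (disjList ((List.range n).map (pv n i)) :: [neg (php n)])) := by
    refine subsetN (N := n + 3) e0 (fun A hA => ?_) (fun X hX => hd4 X ?_) (by omega) ?_ (by simp) (by simp)
    · simp only [List.mem_cons, List.not_mem_nil, or_false] at hA ⊢; tauto
    · simp only [List.mem_cons, List.not_mem_nil, or_false, List.mem_append] at hX ⊢; tauto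
    · simp only [size_disjList_eq_msum, msum_cons, msum_nil, size, hP]; omega
  have e2 := flattenAllS (N := n + 4) _ e1 (p := 4) (fun X hX => hd4 X (by
      simp only [List.mem_cons, List.mem_append] at hX ⊢; tauto)) (by omega)
    (by simp only [hPlen, List.length_singleton]; omega)
    (by simp only [msum_append, msum_cons, msum_nil, hP, size]; omega)
  refine e2.mono ?_
  have h1 : (n + 1) ^ 4 ≤ (n + 2) ^ 4 := Nat.pow_le_pow_left (by omega) 4
  have h2 : (n + 3 + 1) ^ 2 ≤ 4 * (n + 2) ^ 4 := by
    have h21 : (n + 3 + 1) ^ 2 ≤ (2 * (n + 2)) ^ 2 := Nat.pow_le_pow_left (by omega) 2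
    have h22 : (n + 2) ^ 2 ≤ (n + 2) ^ 4 := Nat.pow_le_pow_right (by omega) (by omega)
    nlinarith
  have h3 : (n + 4 + 1) ^ 3 ≤ 27 * (n + 2) ^ 4 := by
    have h31 : (n + 4 + 1) ^ 3 ≤ (3 * (n + 2)) ^ 3 := Nat.pow_le_pow_left (by omega) 3
    have h32 : (n + 2) ^ 3 ≤ (n + 2) ^ 4 := Nat.pow_le_pow_right (by omega) (by omega)
    nlinarith
  have h4 : 16 ≤ (n + 2) ^ 4 := by
    calc 16 = 2 ^ 4 := by norm_num
      _ ≤ (n + 2) ^ 4 := Nat.pow_le_pow_left (by omega) 4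
  omega

variable {i j : ℕ}

/-- **Growth** `⊢ ¬ inp i l, inp (i+1) l, ¬p_{i,j}, ¬R` for every index `l`: a used hole stays
used (`used (i+1) l = p_{i,l} ∨ used i l`); the padding is `⊥ → ⊥`. [folklore] -/
theorem growS (hi : i ≤ n) (l : ℕ) :
    BD (prmD E) (prmB n E) (30 + 150 * (prmM E + 1) ^ 2)
      (disjList (neg (inp n i l) :: inp n (i + 1) l :: (frame₂ hn i j).L)) := by
  obtain ⟨hB0, hD1, hB1, hσ⟩ := prm_facts (n := n) (E := E)
  have hM1 := prmM_ge hn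
  have hc1 : n + 1 ≤ (n + 1) ^ 4 := Nat.le_self_pow (by norm_num) _
  have hH := size_php_le (n := n)
  have dH := dd_neg_php_le (n := n)
  show BD (prmD E) (prmB n E) _ (disjList (neg (inp n i l) :: inp n (i + 1) l :: [neg (pv n i j), neg (php n)]))
  by_cases hl : l < n
  · rw [inp_of_lt hl, inp_of_lt hl, used_succ]
    set U := used n i l with hU
    have sU : U.size = 2 * i + 1 := size_used i l
    have dU : U.dd = 0 := dd_used i l
    have dU1 := altDepthAux_le_dd_succ 1 U
    have hpT : ∀ X ∈ [pv n i l, U, neg U, disj (pv n i l) U, neg (pv n i j), neg (php n)], X.dd ≤ 4 := by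
      intro X hX
      simp only [List.mem_cons, List.not_mem_nil, or_false] at hX
      rcases hX with rfl | rfl | rfl | rfl | rfl | rfl
      · simp [pv]
      · omega
      · rw [dd_neg]; omega
      · rw [dd_disj]; simp [pv, dU]
      · simp [pv]
      · exact dH
    have a0 : BD (prmD E) (prmB n E) 12 (disjList [neg U, U]) := axS U (by omega) (by omega)
    have a1 : BD (prmD E) (prmB n E) (12 + 50 * (prmM E + 1) ^ 2)
        (disjList [pv n i l, U, neg U, neg (pv n i j), neg (php n)]) := by
      refine subsetN (N := prmM E) a0 (fun X hX => ?_) (fun X hX => hpT X ?_) (by omega) ?_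
        (by simp; omega) (by simp; omega)
      · simp only [List.mem_cons, List.not_mem_nil, or_false] at hX ⊢; tauto
      · simp only [List.mem_cons, List.not_mem_nil, or_false] at hX ⊢; tauto
      · simp only [size_disjList_eq_msum, msum_cons, msum_nil, size, pv]; omega
    have a2 := consDisjS a1
    refine (subsetN (N := prmM E) a2 (fun X hX => ?_) (fun X hX => hpT X ?_) (by omega) ?_
      (by simp; omega) (by simp; omega)).mono (by omega)
    · simp only [List.mem_cons, List.not_mem_nil, or_false] at hX ⊢; tauto
    · simp only [List.mem_cons, List.not_mem_nil, or_false] at hX ⊢; tauto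
    · simp only [size_disjList_eq_msum, msum_cons, msum_nil, size, pv]; omega
  · rw [inp_of_le (by omega), inp_of_le (by omega)]
    refine (negBotMemS (N := prmM E) List.mem_cons_self (p := 4) (fun X hX => ?_) (by omega)
      (by simp; omega) ?_).mono (by omega)
    · simp only [List.mem_cons, List.not_mem_nil, or_false] at hX
      rcases hX with rfl | rfl | rfl | rfl
      · simp
      · simp
      · simp [pv]
      · exact dH
    · simp only [msum_cons, msum_nil, size, pv]; omega

/-- **Off before**: `⊢ ¬ inp i j, ¬p_{i,j}, ¬R` — if pigeon `i ≤ n` sits in hole `j < n`, no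
earlier pigeon does (one hole clause per earlier pigeon). [cite: Haken1985, §1 (hole clauses)] -/
theorem offS (hi : i ≤ n) (hj : j < n) :
    BD (prmD E) (prmB n E) (4 + n * (1040 * (n + 1) ^ 4 + 21455))
      (disjList (neg (inp n i j) :: (frame₂ hn i j).L)) := by
  obtain ⟨hB0, hD1, hB1, hσ⟩ := prm_facts (n := n) (E := E)
  have hM1 := prmM_ge hn
  have hc1 : n + 1 ≤ (n + 1) ^ 4 := Nat.le_self_pow (by norm_num) _
  have hH := size_php_le (n := n)
  have dH := dd_neg_php_le (n := n)
  show BD (prmD E) (prmB n E) _ (disjList (neg (inp n i j) :: [neg (pv n i j), neg (php n)]))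
  rw [inp_of_lt hj, used_eq_disjList]
  have hz : ∀ z ∈ usedList n i j, BD (prmD E) (prmB n E) (1040 * (n + 1) ^ 4 + 21420)
      (disjList (neg z :: [neg (pv n i j), neg (php n)])) := by
    intro z hz
    obtain ⟨i', hi', rfl⟩ := mem_usedList_iff.1 hz
    exact (holeClauseS hi' (by omega) hj hB0).weaken hD1 le_rfl
  have hsz : (disjList (usedList n i j)).size = 2 * i + 1 := by rw [← used_eq_disjList, size_used]
  refine (negDisjListS (usedList n i j) hz (p := 4) (fun z hz' => ?_) ?_ (by omega) ?_).mono ?_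
  · obtain ⟨i', -, rfl⟩ := mem_usedList_iff.1 hz'; simp [pv]
  · refine dd_disjList_le fun X hX => ?_
    simp only [List.mem_cons, List.not_mem_nil, or_false] at hX
    rcases hX with rfl | rfl
    · simp [pv]
    · exact dH
  · simp only [size_disjList_eq_msum, msum_cons, msum_nil, size, pv] at hsz ⊢; omega
  · rw [length_usedList]
    exact Nat.add_le_add_left (Nat.mul_le_mul (by omega) (by omega)) _

/-- **On after**: `⊢ inp (i+1) j, ¬p_{i,j}, ¬R` — if pigeon `i` sits in hole `j < n` then
hole `j` is used by a pigeon `< i + 1`. [folklore] -/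
theorem onS (hi : i ≤ n) (hj : j < n) :
    BD (prmD E) (prmB n E) (13 + 50 * (prmM E + 1) ^ 2)
      (disjList (inp n (i + 1) j :: (frame₂ hn i j).L)) := by
  obtain ⟨hB0, hD1, hB1, hσ⟩ := prm_facts (n := n) (E := E)
  have hM1 := prmM_ge hn
  have hc1 : n + 1 ≤ (n + 1) ^ 4 := Nat.le_self_pow (by norm_num) _
  have hH := size_php_le (n := n)
  have dH := dd_neg_php_le (n := n)
  show BD (prmD E) (prmB n E) _ (disjList (inp n (i + 1) j :: [neg (pv n i j), neg (php n)]))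
  rw [inp_of_lt hj, used_succ]
  set U := used n i j with hU
  have sU : U.size = 2 * i + 1 := size_used i j
  have dU : U.dd = 0 := dd_used i j
  have hpT : ∀ X ∈ [pv n i j, U, neg (pv n i j), neg (php n)], X.dd ≤ 4 := by
    intro X hX
    simp only [List.mem_cons, List.not_mem_nil, or_false] at hX
    rcases hX with rfl | rfl | rfl | rfl
    · simp [pv]
    · omega
    · simp [pv]
    · exact dH
  have a0 : BD (prmD E) (prmB n E) 12 (disjList [neg (pv n i j), pv n i j]) :=
    axS (pv n i j) (by simp [pv]; omega) (by simp [size, pv]; omega)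
  have a1 : BD (prmD E) (prmB n E) (12 + 50 * (prmM E + 1) ^ 2)
      (disjList [pv n i j, U, neg (pv n i j), neg (php n)]) := by
    refine subsetN (N := prmM E) a0 (fun X hX => ?_) (fun X hX => hpT X ?_) (by omega) ?_
      (by simp; omega) (by simp; omega)
    · simp only [List.mem_cons, List.not_mem_nil, or_false] at hX ⊢; tauto
    · simp only [List.mem_cons, List.not_mem_nil, or_false] at hX ⊢; tauto
    · simp only [size_disjList_eq_msum, msum_cons, msum_nil, size, pv]; omega
  exact (consDisjS a1).mono (by omega)

end Clauses

end PhpCount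

end Literature.Computability.MetaComplexity
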